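import Summits.Ventures.Crystal3D.Theorems.StickyWulffConstantCoaxialWallLawAutomaton
import HarnessLib

/-!
# The line automaton of the co-axial cell: a free end pays within contact distance one, or is a foreign twin dozen

HONEST FRAMING. Part of the venture `Summits/Ventures/Crystal3D` (cell `crystal3d-full`), helper for the
crux `CoaxialWallLaw` (stmt-Ventures-19481) of `route-Ventures-StickyWulffConstant`, REGISTERED line
`WallLedgerF` (planner cf-p1 gen 16), open stub `stub_coaxialTwoSlabAdhesion` (general fillings).  Brick 4 of
the FLUX-GAP architecture (memo F-FLUXGAP-ARCH §2): the FREE ENDS of the automaton (states of `V` with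
neither a full shell nor a coherent twin dozen, `…AutomatonCount`) are paid.  Rung credit only; F-C1 not
moved.

* `free_end_pay_or_foreign` — a state `(b, c) ∈ V` with `¬Full c b` and `¬TD c b` has an UNSATURATED ball of
  `X` within distance `1` of `b`, or `b` is a twin dozen of class `c` for a FOREIGN `{111}` normal
  `n ≠ ±m` (19480-p1's `line_step`, inputs `KissingGap δ` / `KissingClassification δ` by name; the normal
  `+m` is excluded by `¬TD`, the normal `−m` by the occupied negative slot recorded in `V`).
* `card_near_le_thirteen` — a `1`-separated `X` has at most `13` balls within distance `1` of a given ball.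
* `card_free_ends_le` — **#free ends ≤ 26 · #{unsaturated balls of `X` at heights `[zlo − 1, zcut + 1]`}
  + #{foreign twin-dozen states}** (the residual of the rung).

WHAT THIS IS NOT: the transmitted ends and the ledger are the next files; not the stub; F-C1 not moved.
-/

noncomputable section

namespace Summit.Ventures.Crystal3D.Theorems

open Summit.Ventures.Crystal3D Finset
open Literature.MathematicalPhysics.StatisticalMechanics (fccStacking)
open scoped InnerProductSpace

/-- In a `1`-separated finite set at most `13` points lie within distance `1` of a given point of the set
(the point itself and at most twelve touching it). -/
theorem card_near_le_thirteen (X : Finset (EuclideanSpace ℝ (Fin 3)))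
    (hX : ∀ p ∈ X, ∀ q ∈ X, p ≠ q → 1 ≤ dist p q) {z : EuclideanSpace ℝ (Fin 3)} (hz : z ∈ X) :
    (X.filter fun b => dist b z ≤ 1).card ≤ 13 := by
  classical
  have hsub : (X.filter fun b => dist b z ≤ 1) ⊆ insert z (X.filter fun q => dist z q = 1) := by
    intro b hb
    rw [mem_filter] at hb
    rw [mem_insert, mem_filter]
    by_cases hbz : b = z
    · exact Or.inl hbz
    · right
      refine ⟨hb.1, ?_⟩
      have h1 := hX b hb.1 z hz hbz
      rw [dist_comm]; exact le_antisymm hb.2 h1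
  have h12 := card_filter_dist_eq_one_le_twelve X hX z
  exact (card_le_card hsub).trans ((card_insert_le _ _).trans (by omega))

section Ends

open scoped Classical

variable {X P' : Finset (EuclideanSpace ℝ (Fin 3))} {V : Finset (EuclideanSpace ℝ (Fin 3) × Bool)}
  {F : Bool → (EuclideanSpace ℝ (Fin 3) ≃ₗᵢ[ℝ] EuclideanSpace ℝ (Fin 3))} {m : EuclideanSpace ℝ (Fin 3)}
  {Full TD Inv : Bool → EuclideanSpace ℝ (Fin 3) → Prop} {zlo zcut : ℝ}

/-- **A free end pays or is a foreign twin dozen.**  See the module docstring. -/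
theorem free_end_pay_or_foreign {δ : ℝ} (hg : KissingGap δ) (hc : KissingClassification δ)
    (hX : ∀ p ∈ X, ∀ q ∈ X, p ≠ q → 1 ≤ dist p q)
    (hFull : ∀ c b, Full c b ↔ ∀ w ∈ fccSlots, b + F c w ∈ X)
    (hTD : ∀ c b, TD c b ↔
      ((∀ w ∈ fccSlots, ⟪F c w, m⟫_ℝ ≤ 0 → b + F c w ∈ X) ∧
       (∀ w ∈ fccSlots, ⟪F c w, m⟫_ℝ < 0 → b + (F c w - (2 * ⟪F c w, m⟫_ℝ) • m) ∈ X) ∧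
       (∀ w ∈ fccSlots, 0 < ⟪F c w, m⟫_ℝ → b + F c w ∉ X)))
    (hInv : ∀ c b, Inv c b ↔ ∃ a ∈ fccSlots, ∃ a' ∈ fccSlots, ∃ a'' ∈ fccSlots,
      LinearIndependent ℝ ![a, a', a''] ∧ b + F c a ∈ X ∧ b + F c a' ∈ X ∧ b + F c a'' ∈ X)
    (hV : ∀ v, v ∈ V ↔ (v.1 ∈ X ∧ zlo ≤ v.1 2 ∧ v.1 2 < zcut ∧ v.1 ∉ P' ∧ Inv v.2 v.1 ∧
      ∃ w ∈ fccSlots, ⟪F v.2 w, m⟫_ℝ < 0 ∧ v.1 + F v.2 w ∈ X))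
    {v : EuclideanSpace ℝ (Fin 3) × Bool} (hv : v ∈ V) (hnf : ¬ Full v.2 v.1) (hnt : ¬ TD v.2 v.1) :
    (∃ z ∈ X, dist v.1 z ≤ 1 ∧ (X.filter fun q => dist z q = 1).card ≤ 11) ∨
    (∃ n : EuclideanSpace ℝ (Fin 3), ‖n‖ = 1 ∧ n ≠ m ∧ n ≠ -m ∧
      (∀ w ∈ fccSlots, ⟪F v.2 w, n⟫_ℝ = 0 ∨ ⟪F v.2 w, n⟫_ℝ = Real.sqrt (2 / 3) ∨
        ⟪F v.2 w, n⟫_ℝ = -Real.sqrt (2 / 3)) ∧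
      (∀ w ∈ fccSlots, ⟪F v.2 w, n⟫_ℝ ≤ 0 → v.1 + F v.2 w ∈ X) ∧
      (∀ w ∈ fccSlots, ⟪F v.2 w, n⟫_ℝ < 0 → v.1 + (F v.2 w - (2 * ⟪F v.2 w, n⟫_ℝ) • n) ∈ X) ∧
      (∀ w ∈ fccSlots, 0 < ⟪F v.2 w, n⟫_ℝ → v.1 + F v.2 w ∉ X)) := by
  obtain ⟨hbX, -, -, -, hinv, w₀, hw₀, hw₀n, hw₀X⟩ := (hV v).1 hv
  obtain ⟨a, ha, a', ha', a'', ha'', hind, haX, ha'X, ha''X⟩ := (hInv _ _).1 hinv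
  rcases line_step hg hc hX hbX (F v.2) ha ha' ha'' hind haX ha'X ha''X with
    hpay | hfull | ⟨n, hn, hmenu, hown, hmirror, hfar, -, -, -⟩
  · exact Or.inl hpay
  · exact absurd ((hFull _ _).2 hfull) hnf
  · right
    refine ⟨n, hn, ?_, ?_, hmenu, hown, hmirror, hfar⟩
    · rintro rfl
      exact hnt ((hTD _ _).2 ⟨hown, hmirror, hfar⟩)
    · rintro rfl
      have hpos : 0 < ⟪F v.2 w₀, -m⟫_ℝ := by rw [inner_neg_right]; linarith
      exact hfar w₀ hw₀ hpos hw₀X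

/-- **Counting the free ends.**  See the module docstring. -/
theorem card_free_ends_le {δ : ℝ} (hg : KissingGap δ) (hc : KissingClassification δ)
    (hX : ∀ p ∈ X, ∀ q ∈ X, p ≠ q → 1 ≤ dist p q)
    (hFull : ∀ c b, Full c b ↔ ∀ w ∈ fccSlots, b + F c w ∈ X)
    (hTD : ∀ c b, TD c b ↔
      ((∀ w ∈ fccSlots, ⟪F c w, m⟫_ℝ ≤ 0 → b + F c w ∈ X) ∧
       (∀ w ∈ fccSlots, ⟪F c w, m⟫_ℝ < 0 → b + (F c w - (2 * ⟪F c w, m⟫_ℝ) • m) ∈ X) ∧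
       (∀ w ∈ fccSlots, 0 < ⟪F c w, m⟫_ℝ → b + F c w ∉ X)))
    (hInv : ∀ c b, Inv c b ↔ ∃ a ∈ fccSlots, ∃ a' ∈ fccSlots, ∃ a'' ∈ fccSlots,
      LinearIndependent ℝ ![a, a', a''] ∧ b + F c a ∈ X ∧ b + F c a' ∈ X ∧ b + F c a'' ∈ X)
    (hV : ∀ v, v ∈ V ↔ (v.1 ∈ X ∧ zlo ≤ v.1 2 ∧ v.1 2 < zcut ∧ v.1 ∉ P' ∧ Inv v.2 v.1 ∧
      ∃ w ∈ fccSlots, ⟪F v.2 w, m⟫_ℝ < 0 ∧ v.1 + F v.2 w ∈ X)) :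
    (V.filter fun v => ¬ Full v.2 v.1 ∧ ¬ TD v.2 v.1).card ≤
      26 * (X.filter fun z => (X.filter fun q => dist z q = 1).card ≤ 11 ∧
          zlo - 1 ≤ z 2 ∧ z 2 ≤ zcut + 1).card +
      (V.filter fun v => ∃ n : EuclideanSpace ℝ (Fin 3), ‖n‖ = 1 ∧ n ≠ m ∧ n ≠ -m ∧
        (∀ w ∈ fccSlots, ⟪F v.2 w, n⟫_ℝ = 0 ∨ ⟪F v.2 w, n⟫_ℝ = Real.sqrt (2 / 3) ∨
          ⟪F v.2 w, n⟫_ℝ = -Real.sqrt (2 / 3)) ∧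
        (∀ w ∈ fccSlots, ⟪F v.2 w, n⟫_ℝ ≤ 0 → v.1 + F v.2 w ∈ X) ∧
        (∀ w ∈ fccSlots, ⟪F v.2 w, n⟫_ℝ < 0 → v.1 + (F v.2 w - (2 * ⟪F v.2 w, n⟫_ℝ) • n) ∈ X) ∧
        (∀ w ∈ fccSlots, 0 < ⟪F v.2 w, n⟫_ℝ → v.1 + F v.2 w ∉ X)).card := by
  set U := X.filter fun z => (X.filter fun q => dist z q = 1).card ≤ 11 ∧
      zlo - 1 ≤ z 2 ∧ z 2 ≤ zcut + 1 with hU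
  set FOR := V.filter fun v => ∃ n : EuclideanSpace ℝ (Fin 3), ‖n‖ = 1 ∧ n ≠ m ∧ n ≠ -m ∧
      (∀ w ∈ fccSlots, ⟪F v.2 w, n⟫_ℝ = 0 ∨ ⟪F v.2 w, n⟫_ℝ = Real.sqrt (2 / 3) ∨
        ⟪F v.2 w, n⟫_ℝ = -Real.sqrt (2 / 3)) ∧
      (∀ w ∈ fccSlots, ⟪F v.2 w, n⟫_ℝ ≤ 0 → v.1 + F v.2 w ∈ X) ∧
      (∀ w ∈ fccSlots, ⟪F v.2 w, n⟫_ℝ < 0 → v.1 + (F v.2 w - (2 * ⟪F v.2 w, n⟫_ℝ) • n) ∈ X) ∧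
      (∀ w ∈ fccSlots, 0 < ⟪F v.2 w, n⟫_ℝ → v.1 + F v.2 w ∉ X) with hFOR
  set PAY := V.filter fun v => ∃ z ∈ U, dist v.1 z ≤ 1 with hPAY
  -- split
  have hsplit : (V.filter fun v => ¬ Full v.2 v.1 ∧ ¬ TD v.2 v.1) ⊆ PAY ∪ FOR := by
    intro v hv
    rw [mem_filter] at hv
    obtain ⟨hvV, hnf, hnt⟩ := hv
    rw [mem_union]
    rcases free_end_pay_or_foreign hg hc hX hFull hTD hInv hV hvV hnf hnt with ⟨z, hz, hd, hdeg⟩ | hfor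
    · left
      rw [hPAY, mem_filter]
      refine ⟨hvV, z, ?_, hd⟩
      obtain ⟨-, hzlo, hzcut, -⟩ := (hV v).1 hvV
      have h2 : (v.1 2 - z 2) ^ 2 ≤ 1 := by
        have h1 := sq_sub_apply_le_dist_sq v.1 z 2
        have h0 : 0 ≤ dist v.1 z := dist_nonneg
        nlinarith
      have h2' : |v.1 2 - z 2| ≤ 1 := by
        rw [← sq_le_one_iff_abs_le_one]; exact h2
      obtain ⟨h2a, h2b⟩ := abs_le.1 h2'
      rw [hU, mem_filter]
      exact ⟨hz, hdeg, by linarith, by linarith⟩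
    · right
      rw [hFOR, mem_filter]
      exact ⟨hvV, hfor⟩
  -- the paying ends, fibre by fibre
  have hPAYle : PAY.card ≤ 26 * U.card := by
    have hcover : PAY ⊆ U.biUnion fun z => (X.filter fun b => dist b z ≤ 1) ×ˢ (univ : Finset Bool) := by
      intro v hv
      rw [hPAY, mem_filter] at hv
      obtain ⟨hvV, z, hz, hd⟩ := hv
      rw [mem_biUnion]
      refine ⟨z, hz, ?_⟩
      rw [mem_product, mem_filter]
      exact ⟨⟨((hV v).1 hvV).1, hd⟩, mem_univ _⟩
    refine (card_le_card hcover).trans ((card_biUnion_le).trans ?_)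
    have : ∀ z ∈ U, ((X.filter fun b => dist b z ≤ 1) ×ˢ (univ : Finset Bool)).card ≤ 26 := by
      intro z hz
      rw [card_product, card_univ, Fintype.card_bool]
      have := card_near_le_thirteen X hX (mem_filter.1 hz).1 (z := z)
      omega
    calc ∑ z ∈ U, ((X.filter fun b => dist b z ≤ 1) ×ˢ (univ : Finset Bool)).card
        ≤ ∑ z ∈ U, 26 := sum_le_sum this
      _ = 26 * U.card := by rw [sum_const, smul_eq_mul, mul_comm]
  calc (V.filter fun v => ¬ Full v.2 v.1 ∧ ¬ TD v.2 v.1).card ≤ (PAY ∪ FOR).card := card_le_card hsplit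
    _ ≤ PAY.card + FOR.card := card_union_le _ _
    _ ≤ 26 * U.card + FOR.card := by omega

end Ends

end Summit.Ventures.Crystal3D.Theorems

end
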